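import Summits.Ventures.LatticeQCDFlow.Exactness.FlowSamplerMixtureHarmonicMean
import Summits.Ventures.LatticeQCDFlow.Exactness.Phi4LatticeSymmetry
import HarnessLib

/-!
# Averaging a flow over a finite family of symmetries is never worse than the harmonic mean over the relabelled flows — for EVERY square-integrable observable, no sector hypothesis

HONEST FRAMING: exact (Metropolis-corrected) sampling algorithms for lattice gauge theory;
figures of merit are autocorrelation/cost numbers at stated couplings and volumes; no
continuum-physics claim.  (SCALAR calibration rung S0-A: not a gauge result.)

Venture `LatticeQCDFlow` (cell pub-lqcd), topic `Exactness`; FANOUT row 2 (`s0-phi4`, FLOW arm).  NEW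
WORK of the cell: the group-averaged flow `q̄ = |G|⁻¹ Σ_a q̃ ∘ t_a` of
`FlowSamplerGroupSymmetrisation{,Dirichlet,TauInt}` is the uniform MIXTURE of the relabelled flows
`q̃ ∘ t_a`, so `FlowSamplerMixtureHarmonicMean` applies: for EVERY square-integrable centred `g` with
`∫ g² w > 0` whose series is summable under each relabelled sampler `imhOp μ w (q̃ ∘ t_a)`,

  **`τ_int^{q̄}(g) + ½ ≤ |G| / Σ_a (τ_int^{q̃∘t_a}(g) + ½)⁻¹ ≤ |G|⁻¹ Σ_a (τ_int^{q̃∘t_a}(g) + ½)`.**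

This complements the SECTOR theorem (`groupAvg_tauInt_le_of_covariant`: for covariant `g` every term
equals `τ_int^{q̃}(g)`, so the bound is `τ_int^{q̃}(g)` itself) and explains the mixed-parity witness
(`FlowSamplerSymmetrisationMixedParity`: the relabelled flow is much worse on that `g`, and the
symmetrised value lies below the harmonic mean of the two).  Only measure preservation of the `t_a` is
used (normalisation of `q̃ ∘ t_a`); invariance of `w` is NOT needed for this bound.  The lattice instance
for the signed site symmetries of φ⁴ (`Phi4LatticeSymmetry`) is drawn for every `PolyObs` observable.
Nothing is cited as a fact.

## What is proved

* `mixtureTwo_tauInt_le_harmonicMean` — two flows `a q̃₁ + (1 − a) q̃₂` (the setting of the MIX file);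
* **`symmetrised_tauInt_le_harmonicMean`** — `τ_int^{q̃ₛ}(g) + ½ ≤ 2/((τ_int^{q̃}(g) + ½)⁻¹ + (τ_int^{q̃∘σ}(g) + ½)⁻¹)`
  for EVERY square-integrable `g` (the positive statement behind the three-state witness of
  `FlowSamplerSymmetrisationMixedParity`, where the relabelled flow `q̃ ∘ σ` is much worse on `g` than
  `q̃` and the symmetrised value `7/6` lies between `5/6` and the harmonic-mean bound);
* **`groupAvg_tauInt_le_harmonicMean`** (general, any finite nonempty family of measure-preserving
  `t_a`, any positive normalised `q̃`); `groupAvg_tauInt_le_arithMean`;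
* **`phi4LatticeAvg_tauInt_le_harmonicMean`** — lattice φ⁴, every `λ > 0`, real `J`, any finite family
  of signed site symmetries (no `J`-automorphism hypothesis needed here), every `f ∈ PolyObs`;
* **`phi4FlowSym_tauInt_le_harmonicMean`** — lattice `Z₂`: every `f ∈ PolyObs`, mixed parity allowed
  (the complement of `Phi4FlowSymmetrisedParity`, which orders even and odd `f` exactly).

NOT CLAIMED: per-cost statements; equality cases; any value for any network.
-/

namespace Summit.Ventures.LatticeQCDFlow.Exactness

open Real MeasureTheory Filter Finset Set Topology
open Summit.Ventures.LatticeQCDFlow.Scoring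

section General

variable {X : Type*} [MeasurableSpace X] {μ : Measure X} [SFinite μ] {w q : X → ℝ}
  {ι : Type*} [Fintype ι] [Nonempty ι] {t : ι → X ≃ᵐ X}

omit [MeasurableSpace X] [Nonempty ι] in
/-- The group average is the uniform mixture of the relabelled densities. -/
theorem groupAvg_eq_finMixture {t : ι → X → X} (q : X → ℝ) :
    (fun s => (∑ a, q (t a s)) / Fintype.card ι)
      = fun s => ∑ a, (1 / (Fintype.card ι : ℝ)) * (fun a x => q (t a x)) a s := by
  funext s
  rw [Finset.sum_div]
  exact Finset.sum_congr rfl fun a _ => by ring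

/-- **THE AVERAGED FLOW IS NEVER WORSE THAN THE HARMONIC MEAN OVER THE RELABELLED FLOWS**, for every
square-integrable `g` with `∫ g² w > 0` whose series is summable under each `imhOp μ w (q̃ ∘ t_a)`:
summable under `imhOp μ w q̄` and `τ_int^{q̄}(g) + ½ ≤ 1 / Σ_a |G|⁻¹/(τ_int^{q̃∘t_a}(g) + ½)`. -/
theorem groupAvg_tauInt_le_harmonicMean (ht : ∀ a, MeasurePreserving (t a) μ μ)
    (hw0 : ∀ x, 0 < w x) (hwm : Measurable w) (hwi : Integrable w μ)
    (hq0 : ∀ x, 0 < q x) (hqm : Measurable q) (hqi : Integrable q μ) (hq1 : ∫ z, q z ∂μ = 1)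
    {g : X → ℝ} (hgm : Measurable g) (hg2 : Integrable (fun x => g x ^ 2 * w x) μ)
    (hP : 0 < ∫ x, g x ^ 2 * w x ∂μ)
    (hs : ∀ a, Summable fun n => (∫ x, g x * ((imhOp μ w (fun s => q (t a s)))^[n + 1] g) x * w x ∂μ)
      / ∫ x, g x ^ 2 * w x ∂μ) :
    (Summable fun n => (∫ x, g x * ((imhOp μ w (fun s => (∑ a, q (t a s)) / Fintype.card ι))^[n + 1]
        g) x * w x ∂μ) / ∫ x, g x ^ 2 * w x ∂μ) ∧
    tauInt (fun n => (∫ x, g x * ((imhOp μ w (fun s => (∑ a, q (t a s)) / Fintype.card ι))^[n] g) x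
        * w x ∂μ) / ∫ x, g x ^ 2 * w x ∂μ) + 1 / 2
      ≤ 1 / ∑ a, (1 / (Fintype.card ι : ℝ)) / (tauInt (fun n => (∫ x, g x
          * ((imhOp μ w (fun s => q (t a s)))^[n] g) x * w x ∂μ) / ∫ x, g x ^ 2 * w x ∂μ) + 1 / 2) := by
  have hN : (0 : ℝ) < Fintype.card ι := by exact_mod_cast Fintype.card_pos
  rw [groupAvg_eq_finMixture (t := fun a => (t a : X → X)) q]
  exact finMixture_tauInt_le_harmonicMean (q := fun a x => q (t a x)) (α := fun _ => 1 / (Fintype.card ι : ℝ))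
    (fun _ => div_pos one_pos hN)
    (by rw [Finset.sum_const, Finset.card_univ, nsmul_eq_mul]; field_simp)
    hw0 hwm hwi (fun a x => hq0 _) (fun a => hqm.comp (t a).measurable)
    (fun a => integrable_comp_symmetry ht a hqi)
    (fun a => by rw [integral_comp_symmetry ht a q, hq1]) hgm hg2 hP hs

/-- **… AND NEVER WORSE THAN THEIR ARITHMETIC MEAN**: `τ_int^{q̄}(g) ≤ |G|⁻¹ Σ_a τ_int^{q̃∘t_a}(g)`. -/
theorem groupAvg_tauInt_le_arithMean (ht : ∀ a, MeasurePreserving (t a) μ μ)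
    (hw0 : ∀ x, 0 < w x) (hwm : Measurable w) (hwi : Integrable w μ)
    (hq0 : ∀ x, 0 < q x) (hqm : Measurable q) (hqi : Integrable q μ) (hq1 : ∫ z, q z ∂μ = 1)
    {g : X → ℝ} (hgm : Measurable g) (hg2 : Integrable (fun x => g x ^ 2 * w x) μ)
    (hP : 0 < ∫ x, g x ^ 2 * w x ∂μ)
    (hs : ∀ a, Summable fun n => (∫ x, g x * ((imhOp μ w (fun s => q (t a s)))^[n + 1] g) x * w x ∂μ)
      / ∫ x, g x ^ 2 * w x ∂μ) :
    tauInt (fun n => (∫ x, g x * ((imhOp μ w (fun s => (∑ a, q (t a s)) / Fintype.card ι))^[n] g) x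
        * w x ∂μ) / ∫ x, g x ^ 2 * w x ∂μ)
      ≤ (∑ a, tauInt (fun n => (∫ x, g x * ((imhOp μ w (fun s => q (t a s)))^[n] g) x * w x ∂μ)
          / ∫ x, g x ^ 2 * w x ∂μ)) / Fintype.card ι := by
  have hN : (0 : ℝ) < Fintype.card ι := by exact_mod_cast Fintype.card_pos
  rw [groupAvg_eq_finMixture (t := fun a => (t a : X → X)) q]
  have h := finMixture_tauInt_le_arithMean (q := fun a x => q (t a x)) (α := fun _ => 1 / (Fintype.card ι : ℝ))
    (fun _ => div_pos one_pos hN)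
    (by rw [Finset.sum_const, Finset.card_univ, nsmul_eq_mul]; field_simp)
    hw0 hwm hwi (fun a x => hq0 _) (fun a => hqm.comp (t a).measurable)
    (fun a => integrable_comp_symmetry ht a hqi)
    (fun a => by rw [integral_comp_symmetry ht a q, hq1]) hgm hg2 hP hs
  refine h.trans (le_of_eq ?_)
  rw [← Finset.mul_sum]
  ring

end General

/-! ## Two flows and the `Z₂` symmetrisation (every observable, mixed parity included) -/

section Symmetrisation

variable {X : Type*} [MeasurableSpace X] {μ : Measure X} [SFinite μ] {w q : X → ℝ} {σ : X → X}

/-- **`τ_int^{q̃ₛ}(g) + ½ ≤ HARMONIC MEAN of `τ_int^{q̃}(g) + ½` and `τ_int^{q̃∘σ}(g) + ½`** for EVERY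
square-integrable `g` (`σ` measure preserving and involutive, `q̃ₛ = ½(q̃ + q̃ ∘ σ)`; no parity of `g`, no
symmetry of `w` needed), provided both component series are summable. -/
theorem symmetrised_tauInt_le_harmonicMean (hσ : MeasurePreserving σ μ μ) (hσσ : ∀ x, σ (σ x) = x)
    (hw0 : ∀ x, 0 < w x) (hwm : Measurable w) (hwi : Integrable w μ)
    (hq0 : ∀ x, 0 < q x) (hqm : Measurable q) (hqi : Integrable q μ) (hq1 : ∫ z, q z ∂μ = 1)
    {g : X → ℝ} (hgm : Measurable g) (hg2 : Integrable (fun x => g x ^ 2 * w x) μ)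
    (hP : 0 < ∫ x, g x ^ 2 * w x ∂μ)
    (hs : Summable fun n => (∫ x, g x * ((imhOp μ w q)^[n + 1] g) x * w x ∂μ)
      / ∫ x, g x ^ 2 * w x ∂μ)
    (hsσ : Summable fun n => (∫ x, g x * ((imhOp μ w (fun s => q (σ s)))^[n + 1] g) x * w x ∂μ)
      / ∫ x, g x ^ 2 * w x ∂μ) :
    (Summable fun n => (∫ x, g x * ((imhOp μ w (fun s => (q s + q (σ s)) / 2))^[n + 1] g) x
        * w x ∂μ) / ∫ x, g x ^ 2 * w x ∂μ) ∧
    tauInt (fun n => (∫ x, g x * ((imhOp μ w (fun s => (q s + q (σ s)) / 2))^[n] g) x * w x ∂μ)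
        / ∫ x, g x ^ 2 * w x ∂μ) + 1 / 2
      ≤ 1 / ((1 / 2) / (tauInt (fun n => (∫ x, g x * ((imhOp μ w q)^[n] g) x * w x ∂μ)
              / ∫ x, g x ^ 2 * w x ∂μ) + 1 / 2)
          + (1 / 2) / (tauInt (fun n => (∫ x, g x * ((imhOp μ w (fun s => q (σ s)))^[n] g) x
              * w x ∂μ) / ∫ x, g x ^ 2 * w x ∂μ) + 1 / 2)) := by
  -- the two-component family `(q̃, q̃∘σ)` with weights `(½, ½)`
  have hqσ := integrable_comp_involution hσ hσσ hqi
  have hqσ1 : ∫ z, q (σ z) ∂μ = 1 := by rw [integral_comp_involution hσ hσσ q, hq1]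
  have h := finMixture_tauInt_le_harmonicMean (ι := Fin 2) (μ := μ) (w := w)
    (q := ![q, fun s => q (σ s)]) (α := fun _ => 1 / 2) (fun _ => by norm_num)
    (by simp) hw0 hwm hwi
    (fun i x => by fin_cases i <;> simp [hq0])
    (fun i => by fin_cases i <;> simpa using (by first | exact hqm | exact hqm.comp hσ.measurable))
    (fun i => by fin_cases i <;> simpa using (by first | exact hqi | exact hqσ))
    (fun i => by fin_cases i <;> simpa using (by first | exact hq1 | exact hqσ1))
    hgm hg2 hP (fun i => by fin_cases i <;> simpa using (by first | exact hs | exact hsσ))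
  have e : (fun z => ∑ i : Fin 2, (1 / 2 : ℝ) * (![q, fun s => q (σ s)] : Fin 2 → X → ℝ) i z)
      = fun s => (q s + q (σ s)) / 2 := by
    funext z
    simp [Fin.sum_univ_two]
    ring
  rw [e] at h
  simpa [Fin.sum_univ_two] using h

/-- **TWO FLOWS** (the setting of `FlowSamplerMixtureProposal`): for `0 < a < 1` and every
square-integrable `g` with both component series summable,
`τ_int^{a q̃₁ + (1−a) q̃₂}(g) + ½ ≤ 1/(a/(τ_int^{q̃₁}(g) + ½) + (1 − a)/(τ_int^{q̃₂}(g) + ½))`. -/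
theorem mixtureTwo_tauInt_le_harmonicMean {q₁ q₂ : X → ℝ} {a : ℝ} (ha0 : 0 < a) (ha1 : a < 1)
    (hw0 : ∀ x, 0 < w x) (hwm : Measurable w) (hwi : Integrable w μ)
    (hq1p : ∀ x, 0 < q₁ x) (hq1m : Measurable q₁) (hq1i : Integrable q₁ μ) (hq1n : ∫ z, q₁ z ∂μ = 1)
    (hq2p : ∀ x, 0 < q₂ x) (hq2m : Measurable q₂) (hq2i : Integrable q₂ μ) (hq2n : ∫ z, q₂ z ∂μ = 1)
    {g : X → ℝ} (hgm : Measurable g) (hg2 : Integrable (fun x => g x ^ 2 * w x) μ)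
    (hP : 0 < ∫ x, g x ^ 2 * w x ∂μ)
    (hs1 : Summable fun n => (∫ x, g x * ((imhOp μ w q₁)^[n + 1] g) x * w x ∂μ)
      / ∫ x, g x ^ 2 * w x ∂μ)
    (hs2 : Summable fun n => (∫ x, g x * ((imhOp μ w q₂)^[n + 1] g) x * w x ∂μ)
      / ∫ x, g x ^ 2 * w x ∂μ) :
    (Summable fun n => (∫ x, g x * ((imhOp μ w (fun s => a * q₁ s + (1 - a) * q₂ s))^[n + 1] g) x
        * w x ∂μ) / ∫ x, g x ^ 2 * w x ∂μ) ∧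
    tauInt (fun n => (∫ x, g x * ((imhOp μ w (fun s => a * q₁ s + (1 - a) * q₂ s))^[n] g) x * w x ∂μ)
        / ∫ x, g x ^ 2 * w x ∂μ) + 1 / 2
      ≤ 1 / (a / (tauInt (fun n => (∫ x, g x * ((imhOp μ w q₁)^[n] g) x * w x ∂μ)
              / ∫ x, g x ^ 2 * w x ∂μ) + 1 / 2)
          + (1 - a) / (tauInt (fun n => (∫ x, g x * ((imhOp μ w q₂)^[n] g) x * w x ∂μ)
              / ∫ x, g x ^ 2 * w x ∂μ) + 1 / 2)) := by
  have h := finMixture_tauInt_le_harmonicMean (ι := Fin 2) (μ := μ) (w := w)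
    (q := ![q₁, q₂]) (α := ![a, 1 - a]) (fun i => by fin_cases i <;> simp <;> linarith)
    (by simp) hw0 hwm hwi
    (fun i x => by fin_cases i <;> simp [hq1p, hq2p])
    (fun i => by fin_cases i <;> simpa using (by first | exact hq1m | exact hq2m))
    (fun i => by fin_cases i <;> simpa using (by first | exact hq1i | exact hq2i))
    (fun i => by fin_cases i <;> simpa using (by first | exact hq1n | exact hq2n))
    hgm hg2 hP (fun i => by fin_cases i <;> simpa using (by first | exact hs1 | exact hs2))
  have e : (fun z => ∑ i : Fin 2, (![a, 1 - a] : Fin 2 → ℝ) i * (![q₁, q₂] : Fin 2 → X → ℝ) i z)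
      = fun s => a * q₁ s + (1 - a) * q₂ s := by
    funext z
    simp [Fin.sum_univ_two]
  rw [e] at h
  simpa [Fin.sum_univ_two] using h

end Symmetrisation


/-! ## The lattice -/

section Lattice

variable {n : ℕ} {ι : Type*} [Fintype ι] [Nonempty ι]

/-- **LATTICE φ⁴: AVERAGING ANY FLOW OVER ANY FINITE FAMILY OF SIGNED SITE SYMMETRIES IS NEVER WORSE
THAN THE HARMONIC MEAN OVER THE RELABELLED FLOWS, FOR EVERY POLYNOMIAL OBSERVABLE** (`λ > 0`, real
`J`; `f ∈ PolyObs` with `Var f > 0`; `σ : ι → Sym(Λ)`, `c : ι → ℤˣ` arbitrary — no `J`-automorphism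
hypothesis; summability under each relabelled sampler). -/
theorem phi4LatticeAvg_tauInt_le_harmonicMean {lam : ℝ} (hlam : 0 < lam)
    (J : Fin (n + 1) → Fin (n + 1) → ℝ) (σ : ι → Equiv.Perm (Fin (n + 1))) (c : ι → ℤˣ)
    {q : (Fin (n + 1) → ℝ) → ℝ} (hq0 : ∀ φ, 0 < q φ) (hqm : Measurable q) (hqi : Integrable q)
    (hq1 : ∫ φ, q φ = 1) {f : (Fin (n + 1) → ℝ) → ℝ} (hf : PolyObs f)
    (hP : 0 < ∫ φ, (f φ - gibbsExpect J lam f) ^ 2 * gibbsWeight J lam φ)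
    (hs : ∀ a, Summable fun k => (∫ φ, (f φ - gibbsExpect J lam f)
        * ((imhOpPhi4 J lam (fun ψ => q (latticeSymm (σ a) (c a) ψ)))^[k + 1]
            (fun ψ => f ψ - gibbsExpect J lam f)) φ * gibbsWeight J lam φ)
        / ∫ φ, (f φ - gibbsExpect J lam f) ^ 2 * gibbsWeight J lam φ) :
    (Summable fun k => (∫ φ, (f φ - gibbsExpect J lam f)
        * ((imhOpPhi4 J lam (fun ψ => (∑ a, q (latticeSymm (σ a) (c a) ψ)) / Fintype.card ι))^[k + 1]
            (fun ψ => f ψ - gibbsExpect J lam f)) φ * gibbsWeight J lam φ)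
        / ∫ φ, (f φ - gibbsExpect J lam f) ^ 2 * gibbsWeight J lam φ) ∧
    tauInt (fun k => (∫ φ, (f φ - gibbsExpect J lam f)
        * ((imhOpPhi4 J lam (fun ψ => (∑ a, q (latticeSymm (σ a) (c a) ψ)) / Fintype.card ι))^[k]
            (fun ψ => f ψ - gibbsExpect J lam f)) φ * gibbsWeight J lam φ)
        / ∫ φ, (f φ - gibbsExpect J lam f) ^ 2 * gibbsWeight J lam φ) + 1 / 2
      ≤ 1 / ∑ a, (1 / (Fintype.card ι : ℝ)) / (tauInt (fun k => (∫ φ, (f φ - gibbsExpect J lam f)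
          * ((imhOpPhi4 J lam (fun ψ => q (latticeSymm (σ a) (c a) ψ)))^[k]
              (fun ψ => f ψ - gibbsExpect J lam f)) φ * gibbsWeight J lam φ)
          / ∫ φ, (f φ - gibbsExpect J lam f) ^ 2 * gibbsWeight J lam φ) + 1 / 2) := by
  obtain ⟨hgm, hg2⟩ := polyObs_sq_integrable hlam J (polyObs_sub_const hf (gibbsExpect J lam f))
  simp only [imhOpPhi4_eq_imhOp] at hs ⊢
  exact groupAvg_tauInt_le_harmonicMean (μ := volume) (t := fun a => latticeSymm (σ a) (c a))
    (fun a => measurePreserving_latticeSymm (σ a) (c a)) (fun φ => gibbsWeight_pos J lam φ)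
    (continuous_gibbsWeight J lam).measurable (integrable_gibbsWeight hlam J) hq0 hqm hqi hq1 hgm hg2
    hP hs

/-- **LATTICE φ⁴, THE `Z₂` SYMMETRISATION, EVERY POLYNOMIAL OBSERVABLE** (mixed parity allowed — the
complement of `Phi4FlowSymmetrisedParity`): `τ_int^{q̃ₛ}(f) + ½ ≤ 2/((τ_int^{q̃}(f) + ½)⁻¹ + (τ_int^{q̃∘(−)}(f) + ½)⁻¹)`
whenever both component series are summable (`λ > 0`, real `J`, any positive normalised `q̃`). -/
theorem phi4FlowSym_tauInt_le_harmonicMean {lam : ℝ} (hlam : 0 < lam)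
    (J : Fin (n + 1) → Fin (n + 1) → ℝ) {q : (Fin (n + 1) → ℝ) → ℝ} (hq0 : ∀ φ, 0 < q φ)
    (hqm : Measurable q) (hqi : Integrable q) (hq1 : ∫ φ, q φ = 1) {f : (Fin (n + 1) → ℝ) → ℝ}
    (hf : PolyObs f) (hP : 0 < ∫ φ, (f φ - gibbsExpect J lam f) ^ 2 * gibbsWeight J lam φ)
    (hs : Summable fun k => (∫ φ, (f φ - gibbsExpect J lam f)
        * ((imhOpPhi4 J lam q)^[k + 1] (fun ψ => f ψ - gibbsExpect J lam f)) φ * gibbsWeight J lam φ)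
        / ∫ φ, (f φ - gibbsExpect J lam f) ^ 2 * gibbsWeight J lam φ)
    (hsσ : Summable fun k => (∫ φ, (f φ - gibbsExpect J lam f)
        * ((imhOpPhi4 J lam (fun ψ => q (-ψ)))^[k + 1] (fun ψ => f ψ - gibbsExpect J lam f)) φ
          * gibbsWeight J lam φ)
        / ∫ φ, (f φ - gibbsExpect J lam f) ^ 2 * gibbsWeight J lam φ) :
    (Summable fun k => (∫ φ, (f φ - gibbsExpect J lam f)
        * ((imhOpPhi4 J lam (fun ψ => (q ψ + q (-ψ)) / 2))^[k + 1]
            (fun ψ => f ψ - gibbsExpect J lam f)) φ * gibbsWeight J lam φ)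
        / ∫ φ, (f φ - gibbsExpect J lam f) ^ 2 * gibbsWeight J lam φ) ∧
    tauInt (fun k => (∫ φ, (f φ - gibbsExpect J lam f)
        * ((imhOpPhi4 J lam (fun ψ => (q ψ + q (-ψ)) / 2))^[k]
            (fun ψ => f ψ - gibbsExpect J lam f)) φ * gibbsWeight J lam φ)
        / ∫ φ, (f φ - gibbsExpect J lam f) ^ 2 * gibbsWeight J lam φ) + 1 / 2
      ≤ 1 / ((1 / 2) / (tauInt (fun k => (∫ φ, (f φ - gibbsExpect J lam f)
              * ((imhOpPhi4 J lam q)^[k] (fun ψ => f ψ - gibbsExpect J lam f)) φ * gibbsWeight J lam φ)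
              / ∫ φ, (f φ - gibbsExpect J lam f) ^ 2 * gibbsWeight J lam φ) + 1 / 2)
          + (1 / 2) / (tauInt (fun k => (∫ φ, (f φ - gibbsExpect J lam f)
              * ((imhOpPhi4 J lam (fun ψ => q (-ψ)))^[k] (fun ψ => f ψ - gibbsExpect J lam f)) φ
                * gibbsWeight J lam φ)
              / ∫ φ, (f φ - gibbsExpect J lam f) ^ 2 * gibbsWeight J lam φ) + 1 / 2)) := by
  obtain ⟨hgm, hg2⟩ := polyObs_sq_integrable hlam J (polyObs_sub_const hf (gibbsExpect J lam f))
  simp only [imhOpPhi4_eq_imhOp] at hs hsσ ⊢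
  exact symmetrised_tauInt_le_harmonicMean (μ := volume) (σ := fun ψ : Fin (n + 1) → ℝ => -ψ)
    measurePreserving_neg_pi (fun φ => neg_neg φ) (fun φ => gibbsWeight_pos J lam φ)
    (continuous_gibbsWeight J lam).measurable (integrable_gibbsWeight hlam J) hq0 hqm hqi hq1 hgm hg2
    hP hs hsσ

end Lattice

end Summit.Ventures.LatticeQCDFlow.Exactness
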